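import Literature.NumberTheory.DiophantineApproximation.RidoutAssembly
import Literature.NumberTheory.DiophantineApproximation.PadicRothIntegers

/-!
# The `p`-adic Roth theorem over `ℚ` (Ridout) — V. Ridout's theorem for integers; BEG Thm. 2.1 (i)

Last file of the proof of the `p`-adic Thue–Siegel–Roth theorem for integers over `ℚ` (D. Ridout
1958 [Ridout1958]; K. Mahler 1961 [Mahler1961]; Bombieri–Gubler [BombieriGubler2006] Thm. 6.2.3
with 6.2.5–6.2.6) on top of the tree's proof of Roth's theorem after Schmidt [Schmidt1980]
(`DiophantineGeometry/Roth*`; this directory's `RidoutIndexTheorem`, `RidoutLocalEstimates`,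
`RidoutClasses`, `RidoutAssembly`), and the discharge of the named fact
`BugeaudEvertseGyory2018_SPartPolynomialValues` (Bugeaud–Evertse–Győry, Acta Arith. 184 (2018),
Thm. 2.1 (i) [BugeaudEvertseGyory2018]) through the reduction
`BugeaudEvertseGyory2018_SPartPolynomialValues_of_padicRoth` (`SPartPolynomialValuesProofs.lean`).

* `Ridout.finite_of_num_le` — Ridout's theorem over `ℚ` for approximations with bounded
  numerators: for roots `θ_p ∈ \overline{ℚ_p}` of monic `Q_p ∈ ℤ[X]` (`p ∈ S`), `c₀`, `ε > 0`, only
  finitely many `ρ ∈ ℚ` with `|num ρ| ≤ c₀` have `Π_{p∈S} min(1,|ρ − θ_p|_p) < den(ρ)^{−1−ε}`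
  (Mahler's classes `Ridout.exists_class` + `Ridout.false_of_class`).
* `Ridout.padicRoth_int` — **B–G 6.2.6 for several primes, PROVED**: for `α_p ∈ \overline{ℚ_p}`
  algebraic over `ℚ` and `ε > 0`, `Π_{p∈S} min(1,|n − α_p|_p) < |n|^{−1−ε}` has only finitely many
  solutions `n ∈ ℤ` (Möbius transformation `n ↦ c/(n+t)`, B–G 6.2.5, onto the previous result).
* `BugeaudEvertseGyory2018_SPartPolynomialValues_holds` — the named fact, discharged.

## References

* [Ridout1958] D. Ridout, *The `p`-adic generalization of the Thue–Siegel–Roth theorem*,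
  Mathematika 5 (1958) 40–48.
* [Mahler1961] K. Mahler, *Lectures on Diophantine approximations I*, Notre Dame 1961.
* [BombieriGubler2006] E. Bombieri, W. Gubler, *Heights in Diophantine Geometry*, CUP 2006,
  Thm. 6.2.3, 6.2.5–6.2.6 (PDF p. 151), §6.4.
* [Schmidt1980] W. M. Schmidt, *Diophantine Approximation*, LNM 785, Springer 1980, Ch. V.
* [BugeaudEvertseGyory2018] Y. Bugeaud, J.-H. Evertse, K. Győry, Acta Arith. 184 (2018),
  Thm. 2.1 (i) and §3.
-/

noncomputable section

open MvPolynomial Finset Real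
open scoped Polynomial

namespace Literature.NumberTheory.DiophantineApproximation

namespace Ridout

open Literature.NumberTheory.DiophantineGeometry.Roth

/-- **Ridout's theorem over `ℚ`, bounded numerators** (the `S ∪ {∞}` case of Bombieri–Gubler
Thm. 6.2.3 with `α_∞ = 0` after the Möbius transformation of 6.2.5, restricted to approximations
`ρ = a/q` with `|a| ≤ c₀`, which is what 6.2.6 needs): for a finite set of primes `S`, roots
`θ_p ∈ \overline{ℚ_p}` of monic `Q_p ∈ ℤ[X]`, `c₀ ∈ ℕ` and `ε > 0`, only finitely many rationals
`ρ` with `|num ρ| ≤ c₀` satisfy `Π_{p∈S} min(1, |ρ − θ_p|_p) < den(ρ)^{-(1+ε)}`.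
Proof: otherwise, discarding the finitely many `ρ` with `den ρ = 1` or `ρ = θ_p` for some `p`,
Mahler's reduction `Ridout.exists_class` (with `N > 2|S|(1+ε)/ε`) produces an infinite class with
`(1+ε) Σ λ_p ≥ 1 + ε/2`, contradicting `Ridout.false_of_class`.
[cite: BombieriGubler2006, Thm. 6.2.3 with 6.2.5–6.2.6 (K = ℚ); Ridout1958] -/
theorem finite_of_num_le (S : Finset Nat.Primes) (Q : Nat.Primes → ℤ[X])
    (hQm : ∀ p ∈ S, (Q p).Monic) (hQd : ∀ p ∈ S, 1 ≤ (Q p).natDegree)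
    (θ : ∀ p : Nat.Primes, @PadicAlgCl (p : ℕ) ⟨p.2⟩)
    (hθ : ∀ p ∈ S, Polynomial.aeval (θ p) (Q p) = 0) (c₀ : ℕ) {ε : ℝ} (hε : 0 < ε) :
    {ρ : ℚ | |ρ.num| ≤ c₀ ∧ (∏ p ∈ S, min 1 ‖(ρ : @PadicAlgCl (p : ℕ) ⟨p.2⟩) - θ p‖) <
      (ρ.den : ℝ) ^ (-(1 + ε))}.Finite := by
  classical
  have _inst (p : Nat.Primes) : Fact (p : ℕ).Prime := ⟨p.2⟩
  by_contra hinf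
  -- the exceptional points: `den ρ ≤ 1`, or `ρ = θ_p` for some `p ∈ S`
  set Bad : Set ℚ := {ρ : ℚ | |ρ.num| ≤ c₀ ∧ ρ.den ≤ 1} ∪
    ⋃ p ∈ S, {ρ : ℚ | (ρ : PadicAlgCl (p : ℕ)) = θ p} with hBad
  have hBadfin : Bad.Finite := by
    refine Set.Finite.union ?_ (Set.Finite.biUnion S.finite_toSet fun p _ => ?_)
    · -- bounded numerator and denominator
      have hsub : {ρ : ℚ | |ρ.num| ≤ c₀ ∧ ρ.den ≤ 1} ⊆ (fun ρ : ℚ => (ρ.num, ρ.den)) ⁻¹'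
          ((Finset.Icc (-(c₀ : ℤ)) c₀ ×ˢ Finset.Icc 0 1 : Finset (ℤ × ℕ)) : Set (ℤ × ℕ)) := by
        rintro ρ ⟨h1, h2⟩
        simp only [Set.mem_preimage, Finset.coe_product, Finset.coe_Icc, Set.mem_prod, Set.mem_Icc]
        exact ⟨⟨by linarith [neg_abs_le ρ.num], le_of_abs_le h1⟩, ⟨Nat.zero_le _, h2⟩⟩
      refine Set.Finite.subset (Set.Finite.preimage ?_ (Finset.finite_toSet _)) hsub
      intro ρ _ ρ' _ h
      simp only [Prod.mk.injEq] at h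
      exact Rat.ext h.1 h.2
    · -- at most one rational equals `θ_p`
      refine Set.Subsingleton.finite ?_
      intro ρ hρ ρ' hρ'
      exact Rat.cast_injective (hρ.trans hρ'.symm)
  set M : Set ℚ := {ρ : ℚ | |ρ.num| ≤ c₀ ∧ (∏ p ∈ S, min 1 ‖(ρ : PadicAlgCl (p : ℕ)) - θ p‖) <
      (ρ.den : ℝ) ^ (-(1 + ε))} \ Bad with hM
  have hMinf : M.Infinite := Set.Infinite.sdiff hinf hBadfin
  have hMden : ∀ ρ ∈ M, 2 ≤ ρ.den := by
    rintro ρ ⟨⟨hnum, -⟩, hbad⟩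
    by_contra hlt
    exact hbad (Or.inl ⟨hnum, by omega⟩)
  have hMpos : ∀ ρ ∈ M, ∀ p ∈ S, 0 < ‖(ρ : PadicAlgCl (p : ℕ)) - θ p‖ := by
    rintro ρ ⟨-, hbad⟩ p hp
    rw [norm_pos_iff, sub_ne_zero]
    intro h
    exact hbad (Or.inr (Set.mem_biUnion (Finset.mem_coe.mpr hp) h))
  -- Mahler's classes
  set N : ℕ := ⌈2 * S.card * (1 + ε) / ε⌉₊ + 1 with hN
  have hNpos : 0 < N := Nat.succ_pos _
  have hNR : 2 * S.card * (1 + ε) / ε ≤ N := by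
    rw [hN]; push_cast; linarith [Nat.le_ceil (2 * S.card * (1 + ε) / ε)]
  obtain ⟨lam, hlam0, hlamsum, hCinf⟩ := exists_class S
    (fun ρ p => ‖(ρ : PadicAlgCl (p : ℕ)) - θ p‖) hε N hNpos M hMinf hMden hMpos
    (fun ρ hρ => hρ.1.2)
  have hlam : 1 + ε / 2 ≤ (1 + ε) * ∑ p ∈ S, lam p := by
    have hNR' : (0 : ℝ) < N := by exact_mod_cast hNpos
    have h1 : (S.card : ℝ) / N * (1 + ε) ≤ ε / 2 := by
      rw [div_mul_eq_mul_div, div_le_iff₀ hNR']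
      rw [div_le_iff₀ hε] at hNR
      nlinarith
    nlinarith [hlamsum, h1]
  -- the supply from the infinite class
  set C : Set ℚ := {ρ : ℚ | ρ ∈ M ∧ ∀ p ∈ S, min 1 ‖(ρ : PadicAlgCl (p : ℕ)) - θ p‖ ≤
      (ρ.den : ℝ) ^ (-((1 + ε) * lam p))} with hC
  have hsupply : ∀ N₀ : ℕ, ∃ ρ : ℚ, N₀ < ρ.den ∧ (|ρ.num| ≤ c₀ ∧
      ∀ p ∈ S, min 1 ‖(ρ : PadicAlgCl (p : ℕ)) - θ p‖ ≤ (ρ.den : ℝ) ^ (-((1 + ε) * lam p))) := by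
    intro N₀
    obtain ⟨ρ, hρC, hden⟩ := exists_den_gt hCinf c₀ (fun ρ hρ => hρ.1.1.1) N₀
    exact ⟨ρ, hden, hρC.1.1.1, hρC.2⟩
  -- `c₀ ≥ 1` (if `c₀ = 0` the supply consists of `ρ = 0`, of denominator `1`)
  have hc₀ : 1 ≤ c₀ := by
    by_contra h0
    push Not at h0
    obtain ⟨ρ, hden, hnum, -⟩ := hsupply 1
    have hnum0 : ρ.num = 0 := by
      have : |ρ.num| ≤ 0 := by have := hnum; omega
      exact abs_nonpos_iff.mp this
    have : ρ = 0 := Rat.zero_of_num_zero hnum0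
    rw [this] at hden
    simp at hden
  exact false_of_class S Q hQm hQd θ hθ c₀ hc₀ hε lam hlam0 hlam hsupply

/-- **The `p`-adic Thue–Siegel–Roth theorem for integers over `ℚ`** (Ridout 1958 [Ridout1958];
Mahler 1961; Bombieri–Gubler Thm. 6.2.3 with 6.2.5–6.2.6 for `K = ℚ`, `∞ ∈ S`, `α_∞ = ∞`,
`β = n ∈ ℤ`, several primes) — PROVED: for a finite set `S` of primes, `α_p ∈ \overline{ℚ_p}`
algebraic over `ℚ` (`p ∈ S`) and `ε > 0`, `Π_{p∈S} min(1, |n − α_p|_p) < |n|^{−1−ε}` has only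
finitely many solutions `n ∈ ℤ`. This is exactly the hypothesis `hR` of
`BugeaudEvertseGyory2018_SPartPolynomialValues_of_padicRoth`.
Proof (B–G 6.2.5–6.2.6): with `t ≥ 1` such that all `α_p + t ≠ 0`, integers `c_p ≠ 0` making
`c_p (α_p+t)⁻¹` integral (`IsAlgebraic.exists_integral_multiple`) and `c = Π c_p`, the numbers
`θ_p = c (α_p + t)⁻¹` are roots of monic `Q_p = minpoly ℤ θ_p`; a large solution `n` gives
`ρ = c/(n+t)` with `|num ρ| ≤ |c|`, `|n+t|/|c| ≤ den ρ ≤ |n+t| ≤ 2|n|` and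
`Π_p min(1,|ρ − θ_p|_p) ≤ Π_p max(1,|α_p+t|_p⁻²) · |n|^{−1−ε} < den(ρ)^{−1−ε/2}`
(`min_one_norm_inv_sub_inv_le`), i.e. one of the finitely many exceptions of
`Ridout.finite_of_num_le`; `n ↦ c/(n+t)` is injective. (Ridout 1958; restated as Bombieri–Gubler
Thm. 6.2.3 with 6.2.5–6.2.6 for `K = ℚ`, `β = n ∈ ℤ`.)
[cite: BombieriGubler2006, Thm. 6.2.3 with 6.2.5–6.2.6 (K = ℚ, β = n ∈ ℤ); Ridout1958] -/
theorem padicRoth_int (S : Finset Nat.Primes) (α : ∀ p : Nat.Primes, @PadicAlgCl (p : ℕ) ⟨p.2⟩)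
    (hα : ∀ p ∈ S, IsAlgebraic ℚ (α p)) {ε : ℝ} (hε : 0 < ε) :
    {n : ℤ | (∏ p ∈ S, min (1 : ℝ) ‖(n : @PadicAlgCl (p : ℕ) ⟨p.2⟩) - α p‖) <
      |(n : ℝ)| ^ (-(1 + ε))}.Finite := by
  classical
  have _inst (p : Nat.Primes) : Fact (p : ℕ).Prime := ⟨p.2⟩
  -- Step 1: a shift `t ≥ 1` with `α_p + t ≠ 0` for all `p ∈ S`
  set m : Nat.Primes → ℕ := fun p =>
    if h : ∃ z : ℤ, (z : PadicAlgCl (p : ℕ)) = α p then (Classical.choose h).natAbs else 0 with hm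
  set t : ℕ := 1 + ∑ p ∈ S, m p with ht
  have hγ : ∀ p ∈ S, α p + t ≠ 0 := by
    intro p hp h0
    have hex : ∃ z : ℤ, (z : PadicAlgCl (p : ℕ)) = α p :=
      ⟨-(t : ℤ), by rw [eq_neg_of_add_eq_zero_left h0]; push_cast; ring⟩
    have hz := Classical.choose_spec hex
    have hzt : Classical.choose hex = -(t : ℤ) := by
      have h1 : ((Classical.choose hex : ℤ) : PadicAlgCl (p : ℕ)) =
          ((-(t : ℤ) : ℤ) : PadicAlgCl (p : ℕ)) := by
        rw [hz, eq_neg_of_add_eq_zero_left h0]; push_cast; ring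
      exact_mod_cast h1
    have hmp : m p = t := by
      simp only [hm, dif_pos hex, hzt]
      simp
    have : m p ≤ ∑ q ∈ S, m q := Finset.single_le_sum (fun q _ => Nat.zero_le _) hp
    omega
  have ht1 : 1 ≤ t := by omega
  -- Step 2: `γ_p = (α_p + t)⁻¹`, integers `c_p ≠ 0` with `c_p γ_p` integral, `c = Π c_p`,
  -- the algebraic integers `θ_p = c γ_p` and their minimal polynomials
  set γ : ∀ p : Nat.Primes, PadicAlgCl (p : ℕ) := fun p => (α p + t)⁻¹ with hγ_def
  have hγalg : ∀ p ∈ S, IsAlgebraic ℚ (γ p) := fun p hp =>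
    ((hα p hp).add (isAlgebraic_nat t)).inv
  haveI : Algebra.IsAlgebraic ℤ ℚ := IsLocalization.isAlgebraic ℚ (nonZeroDivisors ℤ)
  have hex : ∀ p : Nat.Primes, ∃ y : ℤ, y ≠ 0 ∧ (p ∈ S → IsIntegral ℤ (y • γ p)) := by
    intro p
    by_cases hp : p ∈ S
    · obtain ⟨y, hy0, hint⟩ := ((hγalg p hp).restrictScalars ℤ).exists_integral_multiple
      exact ⟨y, hy0, fun _ => hint⟩
    · exact ⟨1, one_ne_zero, fun h => absurd h hp⟩
  choose cz hcz0 hczint using hex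
  set c : ℤ := ∏ p ∈ S, cz p with hc_def
  have hc0 : c ≠ 0 := Finset.prod_ne_zero_iff.mpr fun p _ => hcz0 p
  set θ : ∀ p : Nat.Primes, PadicAlgCl (p : ℕ) := fun p => (c : PadicAlgCl (p : ℕ)) * γ p
    with hθ_def
  have hθint : ∀ p ∈ S, IsIntegral ℤ (θ p) := by
    intro p hp
    have h1 : θ p = ((∏ p' ∈ S.erase p, cz p' : ℤ) : PadicAlgCl (p : ℕ)) * (cz p • γ p) := by
      rw [hθ_def, zsmul_eq_mul, ← mul_assoc, ← Int.cast_mul, Finset.prod_erase_mul _ _ hp]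
    rw [h1]
    refine IsIntegral.mul ?_ (hczint p hp)
    have := isIntegral_algebraMap (R := ℤ) (A := PadicAlgCl (p : ℕ))
      (x := ∏ p' ∈ S.erase p, cz p')
    simpa using this
  set Q : Nat.Primes → ℤ[X] := fun p => minpoly ℤ (θ p) with hQ_def
  have hQm : ∀ p ∈ S, (Q p).Monic := fun p hp => minpoly.monic (hθint p hp)
  have hQd : ∀ p ∈ S, 1 ≤ (Q p).natDegree := fun p hp => minpoly.natDegree_pos (hθint p hp)
  have hθroot : ∀ p ∈ S, Polynomial.aeval (θ p) (Q p) = 0 := fun p _ => minpoly.aeval ℤ (θ p)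
  -- Step 3: Ridout's theorem with bounded numerators, at `ε/2`
  have hcore := finite_of_num_le S Q hQm hQd θ hθroot c.natAbs (half_pos hε)
  -- Step 4: constants `C = Π C_p ≥ 1`, `D = C 2^{1+ε/2} ≥ 1`, threshold `N = D^{2/ε} + t`
  set Cp : Nat.Primes → ℝ := fun p => max 1 (‖α p + (t : PadicAlgCl (p : ℕ))‖⁻¹ ^ 2) with hCp
  set C : ℝ := ∏ p ∈ S, Cp p with hC
  have hC1 : 1 ≤ C := Finset.one_le_prod fun p _ => le_max_left _ _
  set D : ℝ := C * 2 ^ (1 + ε / 2) with hD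
  have hD1 : 1 ≤ D := by
    rw [hD]
    exact one_le_mul_of_one_le_of_one_le hC1 (Real.one_le_rpow (by norm_num) (by linarith))
  set N : ℝ := D ^ (2 / ε) + t with hN
  have hNt : (t : ℝ) ≤ N := by
    have : 0 ≤ D ^ (2 / ε) := Real.rpow_nonneg (by linarith) _
    linarith
  -- Step 5: the map `n ↦ c/(n+t)` and the key estimate for `|n| ≥ N`
  set T : ℤ → ℚ := fun n => (c : ℚ) / ((n + t : ℤ) : ℚ) with hT
  have hTinj : Function.Injective T := by
    intro n n' h
    simp only [hT, div_eq_mul_inv] at h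
    have h1 := mul_left_cancel₀ (by exact_mod_cast hc0 : (c : ℚ) ≠ 0) h
    rw [inv_inj] at h1
    exact_mod_cast (add_left_injective _ (by exact_mod_cast h1) : n = n')
  have hkey : ∀ n : ℤ, N ≤ |(n : ℝ)| →
      (∏ p ∈ S, min (1 : ℝ) ‖(n : PadicAlgCl (p : ℕ)) - α p‖) < |(n : ℝ)| ^ (-(1 + ε)) →
      T n ∈ {ρ : ℚ | |ρ.num| ≤ c.natAbs ∧
        (∏ p ∈ S, min 1 ‖(ρ : PadicAlgCl (p : ℕ)) - θ p‖) < (ρ.den : ℝ) ^ (-(1 + ε / 2))} := by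
    intro n hn hlt
    -- sizes: `A = |n| ≥ N ≥ t ≥ 1`, `k = n + t ≠ 0`, `|k| ≤ 2A`
    set A : ℝ := |(n : ℝ)| with hA
    have hAt : (t : ℝ) ≤ A := hNt.trans hn
    have hA1 : (1 : ℝ) ≤ A := le_trans (by exact_mod_cast ht1) hAt
    have hA0 : 0 < A := by linarith
    have hDA : D ^ (2 / ε) ≤ A := by
      have : (t : ℝ) + D ^ (2 / ε) ≤ A := by rw [add_comm]; exact hn
      linarith [this, (Nat.cast_nonneg t : (0 : ℝ) ≤ t)]
    set k : ℤ := n + t with hk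
    have hkA : |(k : ℝ)| ≤ 2 * A := by
      rw [hk]; push_cast
      calc |(n : ℝ) + t| ≤ |(n : ℝ)| + |(t : ℝ)| := abs_add_le _ _
        _ = A + t := by rw [hA, Nat.abs_cast]
        _ ≤ 2 * A := by linarith
    have hk0 : k ≠ 0 := by
      intro h0
      have : (n : ℝ) = -t := by
        have : ((n + t : ℤ) : ℝ) = 0 := by rw [← hk, h0]; simp
        push_cast at this; linarith
      have : A = t := by rw [hA, this, abs_neg, Nat.abs_cast]
      have h1 : (1 : ℝ) ≤ D ^ (2 / ε) := Real.one_le_rpow hD1 (by positivity)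
      linarith
    -- numerator and denominator of `ρ = c/k`
    have hTn : T n = Rat.divInt c k := by
      show (c : ℚ) / ((n + t : ℤ) : ℚ) = Rat.divInt c (n + t)
      rw [Rat.intCast_div_eq_divInt]
    have hnum : |(T n).num| ≤ (c.natAbs : ℤ) := by
      rw [hTn, Int.abs_eq_natAbs]
      exact_mod_cast Int.natAbs_le_of_dvd_ne_zero (Rat.num_dvd c hk0) hc0
    have hden_le : ((T n).den : ℝ) ≤ 2 * A := by
      have h1 : (((T n).den : ℕ) : ℤ) ≤ |k| := by
        rw [hTn]
        exact Int.le_of_dvd (abs_pos.mpr hk0) ((Rat.den_dvd c k).trans (dvd_abs _ _ |>.mpr dvd_rfl))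
      have h2 : (((T n).den : ℕ) : ℝ) ≤ ((|k| : ℤ) : ℝ) := by exact_mod_cast h1
      push_cast at h2
      exact h2.trans hkA
    have hdenpos : (0 : ℝ) < (T n).den := by exact_mod_cast (T n).den_pos
    -- the images in `\overline{ℚ_p}` and the local estimates
    have hTp : ∀ p ∈ S, ((T n : ℚ) : PadicAlgCl (p : ℕ)) - θ p =
        (c : PadicAlgCl (p : ℕ)) * (((n : PadicAlgCl (p : ℕ)) + t)⁻¹ - (α p + t)⁻¹) := by
      intro p _
      show (((c : ℚ) / ((n + t : ℤ) : ℚ) : ℚ) : PadicAlgCl (p : ℕ)) -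
          (c : PadicAlgCl (p : ℕ)) * (α p + t)⁻¹ = _
      push_cast
      ring
    have hfac : ∀ p ∈ S, min (1 : ℝ) ‖((T n : ℚ) : PadicAlgCl (p : ℕ)) - θ p‖ ≤
        Cp p * min 1 ‖(n : PadicAlgCl (p : ℕ)) - α p‖ := by
      intro p hp
      have hnorm : ‖((T n : ℚ) : PadicAlgCl (p : ℕ)) - θ p‖ ≤
          ‖((n : PadicAlgCl (p : ℕ)) + t)⁻¹ - (α p + t)⁻¹‖ := by
        rw [hTp p hp, norm_mul]
        exact mul_le_of_le_one_left (norm_nonneg _)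
          (IsUltrametricDist.norm_intCast_le_one _ c)
      exact (min_le_min_left 1 hnorm).trans (min_one_norm_inv_sub_inv_le _ _ _ (hγ p hp))
    have hprod : (∏ p ∈ S, min (1 : ℝ) ‖((T n : ℚ) : PadicAlgCl (p : ℕ)) - θ p‖) ≤
        C * ∏ p ∈ S, min (1 : ℝ) ‖(n : PadicAlgCl (p : ℕ)) - α p‖ := by
      rw [hC, ← Finset.prod_mul_distrib]
      exact Finset.prod_le_prod (fun p _ => le_min zero_le_one (norm_nonneg _)) hfac
    have hprod' : (∏ p ∈ S, min (1 : ℝ) ‖((T n : ℚ) : PadicAlgCl (p : ℕ)) - θ p‖) <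
        C * A ^ (-(1 + ε)) :=
      lt_of_le_of_lt hprod (mul_lt_mul_of_pos_left hlt (by linarith))
    -- exponent bookkeeping: `C A^{-(1+ε)} ≤ den^{-(1+ε/2)}`
    have hexp : C * A ^ (-(1 + ε)) ≤ ((T n).den : ℝ) ^ (-(1 + ε / 2)) := by
      have h2A : (2 * A) ^ (-(1 + ε / 2)) ≤ ((T n).den : ℝ) ^ (-(1 + ε / 2)) :=
        Real.rpow_le_rpow_of_nonpos hdenpos hden_le (by linarith)
      refine le_trans ?_ h2A
      rw [Real.mul_rpow (by norm_num) hA0.le, Real.rpow_neg (by norm_num : (0:ℝ) ≤ 2),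
        ← div_eq_inv_mul, le_div_iff₀ (by positivity)]
      have hsplit : A ^ (-(1 + ε / 2)) = A ^ (ε / 2) * A ^ (-(1 + ε)) := by
        rw [← Real.rpow_add hA0]; congr 1; ring
      have hDle : D ≤ A ^ (ε / 2) := by
        calc D = (D ^ (2 / ε)) ^ (ε / 2) := by
              rw [← Real.rpow_mul (by linarith)]
              rw [show (2 / ε) * (ε / 2) = 1 by field_simp, Real.rpow_one]
          _ ≤ A ^ (ε / 2) :=
              Real.rpow_le_rpow (Real.rpow_nonneg (by linarith) _) hDA (by positivity)
      calc C * A ^ (-(1 + ε)) * 2 ^ (1 + ε / 2) = D * A ^ (-(1 + ε)) := by rw [hD]; ring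
        _ ≤ A ^ (ε / 2) * A ^ (-(1 + ε)) := by gcongr
        _ = A ^ (-(1 + ε / 2)) := hsplit.symm
    exact ⟨hnum, hprod'.trans_le hexp⟩
  -- Step 6: finiteness (small `n` are finitely many; large solutions inject into the core set)
  refine ((Set.finite_Icc (-⌈N⌉) ⌈N⌉).union (hcore.preimage hTinj.injOn)).subset ?_
  intro n hn
  by_cases hsmall : |(n : ℝ)| < N
  · left
    have h1 : (-⌈N⌉ : ℝ) ≤ n := by
      have := (abs_lt.mp hsmall).1
      have := Int.le_ceil N
      linarith
    have h2 : (n : ℝ) ≤ ⌈N⌉ := (le_abs_self _).trans (hsmall.le.trans (Int.le_ceil N))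
    exact ⟨by exact_mod_cast h1, by exact_mod_cast h2⟩
  · right
    exact hkey n (not_lt.mp hsmall) hn

end Ridout

/-- **Bugeaud–Evertse–Győry 2018, Theorem 2.1 (i) — the named fact holds.** For `f ∈ ℤ[X]` of
degree `n ≥ 2` without multiple zeros, a finite non-empty set of primes `S` and `ε > 0`,
`[f(x)]_S ≤ C(f,S,ε) |f(x)|^{1/n+ε}` whenever `f(x) ≠ 0`. Proof: the reduction
`BugeaudEvertseGyory2018_SPartPolynomialValues_of_padicRoth` (the source's §3) fed with the
`p`-adic Thue–Siegel–Roth theorem for integers `Ridout.padicRoth_int` (Ridout 1958; proved in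
`Ridout*.lean` on top of the tree's proof of Roth's theorem after Schmidt).
[cite: BugeaudEvertseGyory2018, Thm. 2.1 (i)] -/
theorem BugeaudEvertseGyory2018_SPartPolynomialValues_holds :
    BugeaudEvertseGyory2018_SPartPolynomialValues :=
  BugeaudEvertseGyory2018_SPartPolynomialValues_of_padicRoth
    fun S α hα _ hε => Ridout.padicRoth_int S α hα hε



end Literature.NumberTheory.DiophantineApproximation

end
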